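import Summits.FinalStateConjecture.FinalStateConjecture.Theorems.ClusterCompletenessOmegaLimitMultiKerrSketchNoHairV8Refutation
import Summits.FinalStateConjecture.FinalStateConjecture.Theorems.TameCensorship.Negative.BoostBlindness
import Literature.Geometry.Lorentzian.KerrEquatorialCalculus
import HarnessLib

/-!
# Crux `ClusterCompleteness.OmegaLimitMultiKerr` (stmt-FinalStateConjecture-17639), line `Sketch` v8 —
# the INNER-HORIZON MASQUERADE, part 1: the squeeze `B = diag(1,1,1,ν)`, the spheroid test for the
# Kerr–Schild radius, and the form `G = B^* g_{M₁,1}`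

Wave-4 adversarial audit of the no-hair stub `stub_noHairUpToGauge` (defect 2 of
`…SketchNoHairV8Refutation`). For `0 < ν < 1` put `M₁ = (1 + ν²)/(2ν)` and let `B w = w + (ν − 1) w³ e₃`
(squeeze of the `z`-axis). This file proves:

* the SPHEROID TEST `R < r_a(x) ↔ R²(R² + a²) < R²(x₁² + x₂²) + (R² + a²) x₃²` (`R > 0`; also with
  `≤`/`=`), from the factorisation `t² − (ρ² − a²)t − a²z² = (t − r²)(t − (ρ² − a² − r²))` of the defining
  quartic with `ρ² − a² − r² ≤ 0` (`lt_radius_iff_spheroid`, `le_radius_iff_spheroid`, `radius_eq_iff_spheroid`);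
* hence `B` maps `{r_ν > 1}` onto `{r_1 > ν}` and `{r_ν = 1}` onto `{r_1 = ν}` (`nu_lt_radius_squeeze_iff`,
  `radius_squeeze_eq_iff`), and `r₊((1+ν²)/2, ν) = 1` (`rPlus_label`): the squeeze puts the INNER horizon
  `{r_1 = ν = r₋(M₁, 1)}` of `g_{M₁,1}` where the event horizon of the label `((1+ν²)/2, ν)` is;
* the form `G(y)(v, w) = g_{M₁,1}(By)(Bv, Bw)` is the pull-back `B^* g_{M₁,1}` (`squeezed_eq_pullMetric`),
  nondegenerate, Lorentzian and Ricci-flat wherever `r_1 ∘ B > 0` (`isInvertible_squeezed`,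
  `squeezed_signature`, `ricAt_squeezed`), and `e₀`-stationary (`B e₀ = e₀`, `Kerr.bilin_add_smul_basisVector_zero`).

Parts 2–4: `…MasqueradeHorizon` (the null inner boundary), `…MasqueradeAnchor` (the `C⁰` anchor),
`…MasqueradeRefutation` (tame bounds; no gauge onto a Kerr exterior; the refutation of the repaired text).
-/

set_option linter.dupNamespace false
set_option maxSynthPendingDepth 3

noncomputable section

open scoped Topology Manifold ContDiff
open Filter Set Function TopologicalSpace Literature.Geometry.Lorentzian
open Summit.FinalStateConjecture.FinalStateConjecture.Theorems.SublinearIsFree.Slaving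
  (ricAt_pullMetric ricAt_kerr_bilin isMetricOn_kerr_bilin)

namespace Summit.FinalStateConjecture.FinalStateConjecture.Theorems.ClusterCompleteness

/-! ### The spheroid test for the Kerr–Schild radius -/

/-- Factorisation of the defining quartic of `r = Kerr.radius a x` (as a quadratic in `t = r²`):
`t² − (ρ² − a²) t − a² z² = (t − r²)(t − (ρ² − a² − r²))` (Vieta). Visser arXiv:0706.0622, (35). [folklore] -/
theorem radius_quartic_factor (a : ℝ) (x : E4) (t : ℝ) :
    t ^ 2 - (E4.spatialNorm x ^ 2 - a ^ 2) * t - a ^ 2 * x 3 ^ 2 =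
      (t - Kerr.radius a x ^ 2) * (t - (E4.spatialNorm x ^ 2 - a ^ 2 - Kerr.radius a x ^ 2)) := by
  linear_combination Kerr.radius_quartic a x

/-- The value of the quadratic at `t = R²` is `R²(R² + a²) − (R²(x₁² + x₂²) + (R² + a²)x₃²)`. [folklore] -/
theorem radius_quartic_at_sq (a R : ℝ) (x : E4) :
    (R ^ 2) ^ 2 - (E4.spatialNorm x ^ 2 - a ^ 2) * R ^ 2 - a ^ 2 * x 3 ^ 2 =
      R ^ 2 * (R ^ 2 + a ^ 2) - (R ^ 2 * (x 1 ^ 2 + x 2 ^ 2) + (R ^ 2 + a ^ 2) * x 3 ^ 2) := by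
  rw [E4.spatialNorm_sq]
  ring

/-- **Spheroid test (strict).** For `R > 0`: `R < r_a(x) ↔ R²(R² + a²) < R²(x₁² + x₂²) + (R² + a²)x₃²`
(the level sets `{r = R}` are the confocal spheroids `(x₁² + x₂²)/(R² + a²) + x₃²/R² = 1`).
Visser arXiv:0706.0622, (35). [folklore] -/
theorem lt_radius_iff_spheroid (a : ℝ) {R : ℝ} (hR : 0 < R) (x : E4) :
    R < Kerr.radius a x ↔
      R ^ 2 * (R ^ 2 + a ^ 2) < R ^ 2 * (x 1 ^ 2 + x 2 ^ 2) + (R ^ 2 + a ^ 2) * x 3 ^ 2 := by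
  have hfac := radius_quartic_factor a x (R ^ 2)
  rw [radius_quartic_at_sq] at hfac
  have hu : E4.spatialNorm x ^ 2 - a ^ 2 - Kerr.radius a x ^ 2 ≤ 0 := by
    linarith [Kerr.spatialNorm_sq_sub_sq_le_radius_sq a x]
  have hpos : 0 < R ^ 2 - (E4.spatialNorm x ^ 2 - a ^ 2 - Kerr.radius a x ^ 2) := by nlinarith
  have hr := Kerr.radius_nonneg a x
  constructor
  · intro h
    have h2 : R ^ 2 - Kerr.radius a x ^ 2 < 0 := by nlinarith
    nlinarith [mul_neg_of_neg_of_pos h2 hpos]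
  · intro h
    have h2 : (R ^ 2 - Kerr.radius a x ^ 2) *
        (R ^ 2 - (E4.spatialNorm x ^ 2 - a ^ 2 - Kerr.radius a x ^ 2)) < 0 := by linarith
    have h3 : R ^ 2 - Kerr.radius a x ^ 2 < 0 := by
      by_contra h4
      exact absurd h2 (not_lt.2 (mul_nonneg (not_lt.1 h4) hpos.le))
    nlinarith

/-- **Spheroid test (weak).** For `R > 0`: `R ≤ r_a(x) ↔ R²(R² + a²) ≤ R²(x₁² + x₂²) + (R² + a²)x₃²`.
[folklore] -/
theorem le_radius_iff_spheroid (a : ℝ) {R : ℝ} (hR : 0 < R) (x : E4) :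
    R ≤ Kerr.radius a x ↔
      R ^ 2 * (R ^ 2 + a ^ 2) ≤ R ^ 2 * (x 1 ^ 2 + x 2 ^ 2) + (R ^ 2 + a ^ 2) * x 3 ^ 2 := by
  have hfac := radius_quartic_factor a x (R ^ 2)
  rw [radius_quartic_at_sq] at hfac
  have hu : E4.spatialNorm x ^ 2 - a ^ 2 - Kerr.radius a x ^ 2 ≤ 0 := by
    linarith [Kerr.spatialNorm_sq_sub_sq_le_radius_sq a x]
  have hpos : 0 < R ^ 2 - (E4.spatialNorm x ^ 2 - a ^ 2 - Kerr.radius a x ^ 2) := by nlinarith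
  have hr := Kerr.radius_nonneg a x
  constructor
  · intro h
    have h2 : R ^ 2 - Kerr.radius a x ^ 2 ≤ 0 := by nlinarith
    nlinarith [mul_nonpos_of_nonpos_of_nonneg h2 hpos.le]
  · intro h
    have h2 : (R ^ 2 - Kerr.radius a x ^ 2) *
        (R ^ 2 - (E4.spatialNorm x ^ 2 - a ^ 2 - Kerr.radius a x ^ 2)) ≤ 0 := by linarith
    have h3 : R ^ 2 - Kerr.radius a x ^ 2 ≤ 0 := by
      by_contra h4
      exact absurd h2 (not_le.2 (mul_pos (not_le.1 h4) hpos))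
    nlinarith

/-- **Spheroid test (equality).** For `R > 0`: `r_a(x) = R ↔ R²(x₁² + x₂²) + (R² + a²)x₃² = R²(R² + a²)`.
[folklore] -/
theorem radius_eq_iff_spheroid (a : ℝ) {R : ℝ} (hR : 0 < R) (x : E4) :
    Kerr.radius a x = R ↔
      R ^ 2 * (x 1 ^ 2 + x 2 ^ 2) + (R ^ 2 + a ^ 2) * x 3 ^ 2 = R ^ 2 * (R ^ 2 + a ^ 2) := by
  rw [le_antisymm_iff, le_radius_iff_spheroid a hR, ← not_lt, lt_radius_iff_spheroid a hR, not_lt,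
    le_antisymm_iff]

/-! ### The labels `((1 + ν²)/2, ν)` and `((1 + ν²)/(2ν), 1)` -/

section Labels

variable {ν : ℝ} (hν0 : 0 < ν) (hν1 : ν < 1)

include hν0 hν1 in
/-- `r₊((1 + ν²)/2, ν) = 1` (`M² − a² = ((1 − ν²)/2)²`). O'Neill 1995, §2.3. [folklore] -/
theorem rPlus_label : Kerr.rPlus ((1 + ν ^ 2) / 2) ν = 1 := by
  unfold Kerr.rPlus
  rw [show ((1 + ν ^ 2) / 2) ^ 2 - ν ^ 2 = ((1 - ν ^ 2) / 2) ^ 2 by ring,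
    Real.sqrt_sq (by nlinarith)]
  ring

include hν0 in
/-- The label `((1 + ν²)/2, ν)` is closed: `|ν| ≤ (1 + ν²)/2`. [folklore] -/
theorem abs_le_label : |ν| ≤ (1 + ν ^ 2) / 2 := by
  rw [abs_of_pos hν0]
  nlinarith [sq_nonneg (1 - ν)]

/-- `0 < (1 + ν²)/2`. [folklore] -/
theorem label_pos : 0 < (1 + ν ^ 2) / 2 := by positivity

include hν0 in
/-- The label `((1 + ν²)/(2ν), 1)` is closed: `|1| ≤ (1 + ν²)/(2ν)`. [folklore] -/
theorem abs_one_le_label₁ : |(1 : ℝ)| ≤ (1 + ν ^ 2) / (2 * ν) := by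
  rw [abs_one, le_div_iff₀ (by positivity)]
  nlinarith [sq_nonneg (1 - ν)]

include hν0 hν1 in
/-- `ν < M₁ = (1 + ν²)/(2ν)`: the inner horizon radius `r₋(M₁, 1) = ν` lies below `M₁`. [folklore] -/
theorem lt_label₁ : ν < (1 + ν ^ 2) / (2 * ν) := by
  rw [lt_div_iff₀ (by positivity)]
  nlinarith

include hν0 hν1 in
/-- Membership in the exterior of the label `((1 + ν²)/2, ν)` is `1 < r_ν`. [folklore] -/
theorem mem_exterior_label_iff (x : E4) :
    x ∈ (boostedKerrExterior 1 0 ((1 + ν ^ 2) / 2) ν : Set E4) ↔ 1 < Kerr.radius ν x := by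
  rw [SetLike.mem_coe, mem_boostedKerrExterior, poincareInv_one_zero, Kerr.mem_exterior,
    rPlus_label hν0 hν1, max_eq_left zero_le_one]

end Labels

/-! ### The squeeze `B = diag(1, 1, 1, ν)` -/

section Squeeze

variable {ν : ℝ} {B B' : E4 →L[ℝ] E4}
  (hB : ∀ w : E4, B w = w + ((ν - 1) * w 3) • E4.basisVector 3)
  (hB' : ∀ w : E4, B' w = w + ((ν⁻¹ - 1) * w 3) • E4.basisVector 3)

include hB in
/-- `(B w)³ = ν w³`. [folklore] -/
theorem squeeze_apply_three (w : E4) : B w 3 = ν * w 3 := by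
  rw [hB w, PiLp.add_apply, PiLp.smul_apply, show (E4.basisVector 3 : E4) 3 = 1 by simp [E4.basisVector]]
  simp only [smul_eq_mul, mul_one]
  ring

include hB in
/-- `(B w)ⁱ = wⁱ` for `i ≠ 3`. [folklore] -/
theorem squeeze_apply_of_ne_three (w : E4) {i : Fin 4} (hi : i ≠ 3) : B w i = w i := by
  rw [hB w, PiLp.add_apply, PiLp.smul_apply,
    show (E4.basisVector 3 : E4) i = 0 by simp [E4.basisVector, hi]]
  simp

include hB in
/-- `B e₀ = e₀`. [folklore] -/
theorem squeeze_basisVector_zero : B (E4.basisVector 0) = E4.basisVector 0 := by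
  rw [hB, show (E4.basisVector 0 : E4) 3 = 0 by simp [E4.basisVector], mul_zero, zero_smul, add_zero]

include hB in
/-- `B (x + s e₀) = B x + s e₀`. [folklore] -/
theorem squeeze_add_smul_basisVector_zero (x : E4) (s : ℝ) :
    B (x + s • E4.basisVector 0) = B x + s • E4.basisVector 0 := by
  rw [map_add, map_smul, squeeze_basisVector_zero hB]

include hB hB' in
/-- `B (B' w) = w` for `ν ≠ 0`. [folklore] -/
theorem squeeze_inverse_apply (hν : ν ≠ 0) (w : E4) : B (B' w) = w := by
  have h3 : B' w 3 = ν⁻¹ * w 3 := by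
    rw [hB' w, PiLp.add_apply, PiLp.smul_apply, show (E4.basisVector 3 : E4) 3 = 1 by simp [E4.basisVector]]
    simp only [smul_eq_mul, mul_one]
    ring
  rw [hB (B' w), h3, hB' w, add_assoc, ← add_smul]
  have : (ν⁻¹ - 1) * w 3 + (ν - 1) * (ν⁻¹ * w 3) = 0 := by
    field_simp
    ring
  rw [this, zero_smul, add_zero]

include hB hB' in
/-- `B' (B w) = w` for `ν ≠ 0`. [folklore] -/
theorem inverse_squeeze_apply (hν : ν ≠ 0) (w : E4) : B' (B w) = w := by
  have h3 : B w 3 = ν * w 3 := squeeze_apply_three hB w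
  rw [hB' (B w), h3, hB w, add_assoc, ← add_smul]
  have : (ν - 1) * w 3 + (ν⁻¹ - 1) * (ν * w 3) = 0 := by
    field_simp
    ring
  rw [this, zero_smul, add_zero]

include hB hB' in
/-- `B` is invertible for `ν ≠ 0`. [folklore] -/
theorem isInvertible_squeeze (hν : ν ≠ 0) : B.IsInvertible :=
  ⟨ContinuousLinearEquiv.equivOfInverse B B' (inverse_squeeze_apply hB hB' hν)
    (squeeze_inverse_apply hB hB' hν), rfl⟩

include hB in
/-- `‖B w‖² = (w⁰)² + (w¹)² + (w²)² + ν²(w³)²`. [folklore] -/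
theorem norm_squeeze_sq (w : E4) : ‖B w‖ ^ 2 = w 0 ^ 2 + w 1 ^ 2 + w 2 ^ 2 + ν ^ 2 * w 3 ^ 2 := by
  rw [EuclideanSpace.real_norm_sq_eq, Fin.sum_univ_four, squeeze_apply_three hB,
    squeeze_apply_of_ne_three hB w (by decide),
    squeeze_apply_of_ne_three hB w (by decide), squeeze_apply_of_ne_three hB w (by decide)]
  ring

include hB in
/-- `‖B w‖ ≤ ‖w‖` for `ν² ≤ 1`. [folklore] -/
theorem norm_squeeze_le (hν : ν ^ 2 ≤ 1) (w : E4) : ‖B w‖ ≤ ‖w‖ := by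
  have h1 := norm_squeeze_sq hB w
  have h2 : ‖w‖ ^ 2 = w 0 ^ 2 + w 1 ^ 2 + w 2 ^ 2 + w 3 ^ 2 := by
    rw [EuclideanSpace.real_norm_sq_eq, Fin.sum_univ_four]
  have h3 : ν ^ 2 * w 3 ^ 2 ≤ w 3 ^ 2 := by nlinarith [sq_nonneg (w 3)]
  exact le_of_pow_le_pow_left₀ two_ne_zero (norm_nonneg _) (by linarith)

include hB in
/-- `‖B w − w‖ ≤ |ν − 1| ‖w‖`. [folklore] -/
theorem norm_squeeze_sub_le (w : E4) : ‖B w - w‖ ≤ |ν - 1| * ‖w‖ := by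
  rw [hB w, add_sub_cancel_left, norm_smul, PiLp.norm_single, norm_one, mul_one,
    Real.norm_eq_abs, abs_mul]
  exact mul_le_mul_of_nonneg_left (TameCensorship.Negative.abs_apply_le_norm w 3) (abs_nonneg _)

include hB in
/-- **The squeeze transports the spheroid test**: `ν < r_1(Bx) ↔ 1 < r_ν(x)` for `ν > 0`
(`ν²(x₁² + x₂²) + (ν² + 1)(νx₃)² = ν² (x₁² + x₂² + (1 + ν²) x₃²)`). [folklore] -/
theorem nu_lt_radius_squeeze_iff (hν : 0 < ν) (x : E4) : ν < Kerr.radius 1 (B x) ↔ 1 < Kerr.radius ν x := by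
  rw [lt_radius_iff_spheroid 1 hν, lt_radius_iff_spheroid ν one_pos, squeeze_apply_three hB,
    squeeze_apply_of_ne_three hB x (by decide), squeeze_apply_of_ne_three hB x (by decide)]
  have hν2 : 0 < ν ^ 2 := by positivity
  have key : ν ^ 2 * (x 1 ^ 2 + x 2 ^ 2) + (ν ^ 2 + 1 ^ 2) * (ν * x 3) ^ 2 - ν ^ 2 * (ν ^ 2 + 1 ^ 2) =
      ν ^ 2 * (1 ^ 2 * (x 1 ^ 2 + x 2 ^ 2) + (1 ^ 2 + ν ^ 2) * x 3 ^ 2 - 1 ^ 2 * (1 ^ 2 + ν ^ 2)) := by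
    ring
  constructor
  · intro h
    have h1 : 0 < ν ^ 2 * (1 ^ 2 * (x 1 ^ 2 + x 2 ^ 2) + (1 ^ 2 + ν ^ 2) * x 3 ^ 2 -
        1 ^ 2 * (1 ^ 2 + ν ^ 2)) := by
      rw [← key]
      linarith
    have h2 := pos_of_mul_pos_right h1 hν2.le
    linarith
  · intro h
    have h1 : 0 < ν ^ 2 * (1 ^ 2 * (x 1 ^ 2 + x 2 ^ 2) + (1 ^ 2 + ν ^ 2) * x 3 ^ 2 -
        1 ^ 2 * (1 ^ 2 + ν ^ 2)) := mul_pos hν2 (by linarith)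
    rw [← key] at h1
    linarith

include hB in
/-- `1 ≤ r_ν(x)` forces `ν ≤ r_1(Bx)` (`ν > 0`): the closed outside of the boundary spheroid is squeezed
into the closed outside of the inner-horizon spheroid. [folklore] -/
theorem nu_le_radius_squeeze (hν : 0 < ν) {x : E4} (h : 1 ≤ Kerr.radius ν x) : ν ≤ Kerr.radius 1 (B x) := by
  rw [le_radius_iff_spheroid ν one_pos] at h
  rw [le_radius_iff_spheroid 1 hν, squeeze_apply_three hB,
    squeeze_apply_of_ne_three hB x (by decide), squeeze_apply_of_ne_three hB x (by decide)]
  have hν2 : 0 < ν ^ 2 := by positivity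
  have key : ν ^ 2 * (x 1 ^ 2 + x 2 ^ 2) + (ν ^ 2 + 1 ^ 2) * (ν * x 3) ^ 2 - ν ^ 2 * (ν ^ 2 + 1 ^ 2) =
      ν ^ 2 * (1 ^ 2 * (x 1 ^ 2 + x 2 ^ 2) + (1 ^ 2 + ν ^ 2) * x 3 ^ 2 - 1 ^ 2 * (1 ^ 2 + ν ^ 2)) := by
    ring
  have h1 : 0 ≤ ν ^ 2 * (1 ^ 2 * (x 1 ^ 2 + x 2 ^ 2) + (1 ^ 2 + ν ^ 2) * x 3 ^ 2 -
      1 ^ 2 * (1 ^ 2 + ν ^ 2)) := mul_nonneg hν2.le (by linarith)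
  rw [← key] at h1
  linarith

include hB in
/-- The boundary spheroid is transported onto the inner-horizon spheroid: `r_1(Bx) = ν ↔ r_ν(x) = 1`
(`ν > 0`). [folklore] -/
theorem radius_squeeze_eq_iff (hν : 0 < ν) (x : E4) : Kerr.radius 1 (B x) = ν ↔ Kerr.radius ν x = 1 := by
  rw [radius_eq_iff_spheroid 1 hν, radius_eq_iff_spheroid ν one_pos, squeeze_apply_three hB,
    squeeze_apply_of_ne_three hB x (by decide), squeeze_apply_of_ne_three hB x (by decide)]
  constructor
  · intro h
    have hν2 : ν ^ 2 ≠ 0 := by positivity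
    apply mul_left_cancel₀ hν2
    nlinarith
  · intro h
    linear_combination ν ^ 2 * h

end Squeeze

/-! ### The squeezed form `G(y)(v, w) = g_{M₁,1}(By)(Bv, Bw)` -/

section Squeezed

variable {ν : ℝ} {B B' : E4 →L[ℝ] E4}
  (hB : ∀ w : E4, B w = w + ((ν - 1) * w 3) • E4.basisVector 3)
  (hB' : ∀ w : E4, B' w = w + ((ν⁻¹ - 1) * w 3) • E4.basisVector 3)
  {M₁ : ℝ} {G : E4 → E4 →L[ℝ] E4 →L[ℝ] ℝ} (hG : ∀ y v w, G y v w = Kerr.bilin M₁ 1 (B y) (B v) (B w))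

include hG in
/-- `G` is the pull-back of `g_{M₁,1}` by the linear change of coordinates `B`. [folklore] -/
theorem squeezed_eq_pullMetric : G = MetricCoord.pullMetric (Kerr.bilin M₁ 1) B := by
  funext y
  ext v w
  rw [MetricCoord.pullMetric_apply, ContinuousLinearMap.fderiv, hG]

include hB hB' hG in
/-- `G(y)` is nondegenerate, hence invertible, wherever `r_1(By) > 0` (`ν ≠ 0`). [folklore] -/
theorem isInvertible_squeezed (hν : ν ≠ 0) {y : E4} (hy : 0 < Kerr.radius 1 (B y)) : (G y).IsInvertible := by
  refine MetricCoord.isInvertible_of_nondegenerate fun v hv ↦ ?_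
  have hBv : B v = 0 := by
    refine Kerr.bilin_nondegenerate M₁ 1 hy (B v) fun u ↦ ?_
    have := hv (B' u)
    rwa [hG, squeeze_inverse_apply hB hB' hν] at this
  have := inverse_squeeze_apply hB hB' hν v
  rw [hBv, map_zero] at this
  exact this.symm

include hB hB' hG in
/-- `G(y)` has Lorentzian signature wherever `r_1(By) > 0` (`0 ≤ M₁`, `ν ≠ 0`): `v = B⁻¹ V(By)`,
`V = −g♯dt*`. Kerr–Schild 1965, §2; O'Neill 1983, Lemma 5.26. [folklore] -/
theorem squeezed_signature (hν : ν ≠ 0) (hM₁ : 0 ≤ M₁) {y : E4} (hy : 0 < Kerr.radius 1 (B y)) :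
    ∃ v : E4, G y v v < 0 ∧ ∀ w : E4, G y v w = 0 → w ≠ 0 → 0 < G y w w := by
  refine ⟨B' (Kerr.timeVector M₁ 1 (B y)), ?_, fun w hw hw0 ↦ ?_⟩
  · rw [hG, squeeze_inverse_apply hB hB' hν]
    exact Kerr.bilin_timeVector_timeVector_neg hM₁ 1 hy
  · rw [hG, squeeze_inverse_apply hB hB' hν] at hw
    rw [hG]
    refine Kerr.bilin_pos_of_orthogonal M₁ 1 hy _ _ (Kerr.bilin_timeVector_timeVector_neg hM₁ 1 hy)
      hw fun h ↦ hw0 ?_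
    have := inverse_squeeze_apply hB hB' hν w
    rw [h, map_zero] at this
    exact this.symm

include hB hB' hG in
/-- `G` is Ricci-flat wherever `r_1(By) > 0`: it is the pull-back of the Ricci-flat `g_{M₁,1}` by `B`
(`ricAt_pullMetric`, `ricAt_kerr_bilin`). Kerr–Schild 1965, §3. [folklore] -/
theorem ricAt_squeezed (hν : ν ≠ 0) {y : E4} (hy : 0 < Kerr.radius 1 (B y)) : MetricCoord.ricAt G y = 0 := by
  have hcc : MetricCoord.IsCoordChangeOn B (B ⁻¹' (Kerr.region 1 0 : Set E4)) (Kerr.region 1 0 : Set E4) :=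
    { isOpen := (Kerr.region 1 0).isOpen.preimage B.continuous
      contDiffOn := B.contDiff.contDiffOn
      mapsTo := fun _ hx ↦ hx
      isInvertible := fun x _ ↦ by
        rw [ContinuousLinearMap.fderiv]
        exact isInvertible_squeeze hB hB' hν }
  have hy' : y ∈ B ⁻¹' (Kerr.region 1 0 : Set E4) := by
    show B y ∈ (Kerr.region 1 0 : Set E4)
    rw [SetLike.mem_coe, Kerr.mem_region, max_self]
    exact hy
  ext Y Z
  rw [squeezed_eq_pullMetric hG, ricAt_pullMetric (isMetricOn_kerr_bilin M₁ 1) hcc hy' Y Z,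
    ricAt_kerr_bilin M₁ 1 hy]
  rfl

include hB hG in
/-- `G(y)(e₀, e₀) = −1 + 2H_{M₁,1}(By)` (`B e₀ = e₀`). [folklore] -/
theorem squeezed_basisVector_zero (y : E4) :
    G y (E4.basisVector 0) (E4.basisVector 0) = -1 + 2 * Kerr.scalarH M₁ 1 (B y) := by
  rw [hG, squeeze_basisVector_zero hB, kerr_bilin_basisVector_zero]

end Squeezed

/-- **Summary (registered sub-goal): the squeeze transports the label's exterior and event horizon onto the
region outside the inner horizon of `g_{M₁,1}` and onto that horizon**: `ν < r_1(Bx) ↔ 1 < r_ν(x)` and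
`r_1(Bx) = ν ↔ r_ν(x) = 1`. [folklore] -/
theorem innerHorizonMasquerade_transport : ∀ ν : ℝ, 0 < ν → ∀ (B : E4 →L[ℝ] E4), (∀ w : E4, B w = w + ((ν - 1) * w 3) • E4.basisVector 3) → ∀ x : E4, (ν < Kerr.radius 1 (B x) ↔ 1 < Kerr.radius ν x) ∧ (Kerr.radius 1 (B x) = ν ↔ Kerr.radius ν x = 1) :=
  fun _ hν _ hB x ↦ ⟨nu_lt_radius_squeeze_iff hB hν x, radius_squeeze_eq_iff hB hν x⟩

end Summit.FinalStateConjecture.FinalStateConjecture.Theorems.ClusterCompleteness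

end
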